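import Mathlib
import Summits.Ventures.PercRepro2.UniversalSeriesFibresDefs

/-! # The series step of (UH*) from the fibre package: relays on the unit sources, fibre matchings on the rest
(seat mine-b, cell pub-perc-repro2; MINE-B.md §28.5)

`universal_ser_of_maps` (UniversalSeriesStep.lean) needs a residual assignment `ψ` that the fibre-wise
design cannot always supply for a general second factor (§27.2).  Here the series product `X ∧ Y` gets
(UH*) from data that are MATCHINGS on the factors alone:

* `f`, `g` — (UH*) assignments of `X` and `Y`;
* `σ`, `τ` — downward maps, injective on the blue-positive elements, with red label `≥ 1` (the drop-free
  Harris relays); `τ` must AGREE with `g` on the UNIT sources of `Y` (`b' z = 1`): `τ z = g (z, 0)` — `σ`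
  need not (the rule R1 takes precedence over R2, and the two are separated by their second coordinate);
* `A x z k` — for a source `x` of `X` with `b x ≥ 2` and a blue-positive `z` of `Y` that is not a unit
  source, the `k`-th unit of `(x, z)` (`k < min (b x) (b' z)`) is sent to the fibre `f (x, i)` at the
  second coordinate `w`, `(i, w) = A x z k`: `w ≤ z`, `r' w ≥ 1`, `b' w ≥ min (b x) (b' z) − 1`, `w` not a
  `g`-image of a unit source nor of a slot of index `< i`, injective in `(z, k)`;
* `B z u k` — symmetrically for a source `z` of `Y` with `b' z ≥ 2` and a red-positive blue-positive `u` of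
  `X`: the first coordinate `y`, `(j, y) = B z u k`, with `y` not an `f`-image of a slot of index `≤ j`.

The kinds and the assignment `fibAssign` are in UniversalSeriesFibresDefs.lean.  The assignment: (R1) `z` a unit source of `Y`: `(x, z) ↦ (σ x, g (z, 0))`; (R2) `x` a unit source of `X`,
`z` not one: `(x, z) ↦ (f (x, 0), τ z)`; (R3) `x` a source with `b x ≥ 2`, `z` not a unit source:
`(x, z, k) ↦ (f (x, i), w)`; (R4) `x` red-positive, `z` a source with `b' z ≥ 2`: `(u, z, k) ↦ (y, g (z, j))`.
The two fibre families meet only at `(f (x, i), g (z, j))`, where an R3-image needs `j ≥ i` and an R4-image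
needs `i > j`.  Red labels are `min 1 _ = 1`, blue levels are automatic.  Census of the data: MINE-B.md §28.6. -/

namespace Summit.Ventures.PercRepro2.UHClosure

open Finset
open Summit.Ventures.PercRepro2.V2Closure (serR serB)

variable {X Y : Type*} [Preorder X] [Preorder Y] [Fintype X] [Fintype Y]

section main

variable (r b : X → ℕ) (r' b' : Y → ℕ)
variable (f : SlotL (USrc r b) b → X) (g : SlotL (USrc r' b') b' → Y)
variable (σ : X → X) (τ : Y → Y) (A : X → Y → ℕ → ℕ × Y) (B : Y → X → ℕ → ℕ × X)
variable (hA1 : ∀ x z k, USrc r b x → 2 ≤ b x → 1 ≤ b' z → ¬ (r' z = 0 ∧ b' z = 1) → k < min (b x) (b' z) →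
      (A x z k).1 < b x)
variable (hB1 : ∀ z u k, USrc r' b' z → 2 ≤ b' z → 1 ≤ r u → 1 ≤ b u → k < min (b' z) (b u) →
      (B z u k).1 < b' z)

include hA1 hB1

/-- **THE SERIES STEP OF (UH*) FROM THE FIBRE PACKAGE** (MINE-B.md §28.5): (UH*) assignments `f`, `g`;
drop-free relays `σ`, `τ`, with `τ` agreeing with `g` on the unit sources of `Y`; fibre data `A` on `Y` for
the sources of `X` with `b ≥ 2` and `B` on `X` for the sources of `Y` with `b' ≥ 2`. -/
theorem universal_ser_of_fibres
    (hf : Function.Injective f) (hfs : ∀ p, f p ≤ p.1.1.1 ∧ r (f p) = 1 ∧ b p.1.1.1 ≤ b (f p) + 1)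
    (hg : Function.Injective g) (hgs : ∀ p, g p ≤ p.1.1.1 ∧ r' (g p) = 1 ∧ b' p.1.1.1 ≤ b' (g p) + 1)
    (hσ : ∀ x x', 1 ≤ b x → 1 ≤ b x' → σ x = σ x' → x = x') (hσs : ∀ x, 1 ≤ b x → σ x ≤ x ∧ 1 ≤ r (σ x))
    (hτ : ∀ z z', 1 ≤ b' z → 1 ≤ b' z' → τ z = τ z' → z = z') (hτs : ∀ z, 1 ≤ b' z → τ z ≤ z ∧ 1 ≤ r' (τ z))
    (hτg : ∀ p : SlotL (USrc r' b') b', b' p.1.1.1 = 1 → τ p.1.1.1 = g p)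
    (hA2 : ∀ x z k, DomA r b r' b' x z k → (A x z k).2 ≤ z)
    (hA3 : ∀ x z k, DomA r b r' b' x z k → 1 ≤ r' (A x z k).2)
    (hA4 : ∀ x z k, DomA r b r' b' x z k → min (b x) (b' z) ≤ b' (A x z k).2 + 1)
    (hA5 : ∀ x z k, DomA r b r' b' x z k → ∀ p : SlotL (USrc r' b') b',
      (b' p.1.1.1 = 1 ∨ p.1.2.val < (A x z k).1) → g p ≠ (A x z k).2)
    (hA6 : ∀ x z k z' k', DomA r b r' b' x z k → DomA r b r' b' x z' k' → A x z k = A x z' k' →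
      z = z' ∧ k = k')
    (hB2 : ∀ z u k, DomB r b r' b' z u k → (B z u k).2 ≤ u)
    (hB3 : ∀ z u k, DomB r b r' b' z u k → 1 ≤ r (B z u k).2)
    (hB4 : ∀ z u k, DomB r b r' b' z u k → min (b' z) (b u) ≤ b (B z u k).2 + 1)
    (hB5 : ∀ z u k, DomB r b r' b' z u k → ∀ p : SlotL (USrc r b) b,
      p.1.2.val ≤ (B z u k).1 → f p ≠ (B z u k).2)
    (hB6 : ∀ z u k u' k', DomB r b r' b' z u k → DomB r b r' b' z u' k' → B z u k = B z u' k' →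
      u = u' ∧ k = k') :
    Universal (serR r r') (serB b b') := by
  refine ⟨fibAssign r b r' b' f g σ τ A B hA1 hB1, ?_, ?_⟩
  · -- injectivity
    intro q q' he
    -- the six cross cases as local facts, the four diagonal cases
    have blue := ser_src_blue r b r' b' q.1.1.2.1
    have blue' := ser_src_blue r b r' b' q'.1.1.2.1
    rcases hq : serKind r b r' b' q with _ | _ | _ | _ <;>
    rcases hq' : serKind r b r' b' q' with _ | _ | _ | _
    · -- (1,1)
      rw [fibAssign_r1 r b r' b' f g σ τ A B hA1 hB1 hq, fibAssign_r1 r b r' b' f g σ τ A B hA1 hB1 hq'] at he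
      obtain ⟨e1, e2⟩ := Prod.mk.inj he
      have hx : q.1.1.1.1 = q'.1.1.1.1 := hσ _ _ blue.1 blue'.1 e1
      have hz : q.1.1.1.2 = q'.1.1.1.2 := (mkSlot_inj r' b' hg e2).1
      exact ser_slot_ext q q' (Prod.ext hx hz)
        (by rw [ser_idx_zero_of_unit r b r' b' (Or.inr (serKind_r1 r b r' b' hq).2),
                ser_idx_zero_of_unit r b r' b' (Or.inr (serKind_r1 r b r' b' hq').2)])
    · -- (1,2)
      exfalso
      rw [fibAssign_r1 r b r' b' f g σ τ A B hA1 hB1 hq, fibAssign_r2 r b r' b' f g σ τ A B hA1 hB1 hq'] at he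
      obtain ⟨-, e2⟩ := Prod.mk.inj he
      have h1 := hτg (mkSlot r' b' q.1.1.1.2 (r1_src r b r' b' hq) 0 (r1_pos r b r' b' hq)) (serKind_r1 r b r' b' hq).2
      simp only [mkSlot_src] at h1
      have hz : q'.1.1.1.2 = q.1.1.1.2 := hτ _ _ blue'.2 blue.2 (by rw [h1]; exact e2.symm)
      apply (serKind_r2 r b r' b' hq').1
      rw [hz]; exact serKind_r1 r b r' b' hq
    · -- (1,3)
      exfalso
      rw [fibAssign_r1 r b r' b' f g σ τ A B hA1 hB1 hq, fibAssign_r3 r b r' b' f g σ τ A B hA1 hB1 hq'] at he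
      obtain ⟨-, e2⟩ := Prod.mk.inj he
      exact hA5 _ _ _ (r3_dom r b r' b' hq') _ (Or.inl (serKind_r1 r b r' b' hq).2) e2
    · -- (1,4)
      exfalso
      rw [fibAssign_r1 r b r' b' f g σ τ A B hA1 hB1 hq, fibAssign_r4 r b r' b' f g σ τ A B hA1 hB1 hq'] at he
      obtain ⟨-, e2⟩ := Prod.mk.inj he
      have hz := (mkSlot_inj r' b' hg e2).1
      have h1 := (serKind_r1 r b r' b' hq).2
      have h2 := (r4_facts r b r' b' hq').2.1
      rw [hz] at h1; omega
    · -- (2,1)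
      exfalso
      rw [fibAssign_r2 r b r' b' f g σ τ A B hA1 hB1 hq, fibAssign_r1 r b r' b' f g σ τ A B hA1 hB1 hq'] at he
      obtain ⟨-, e2⟩ := Prod.mk.inj he
      have h1 := hτg (mkSlot r' b' q'.1.1.1.2 (r1_src r b r' b' hq') 0 (r1_pos r b r' b' hq')) (serKind_r1 r b r' b' hq').2
      simp only [mkSlot_src] at h1
      have hz : q.1.1.1.2 = q'.1.1.1.2 := hτ _ _ blue.2 blue'.2 (by rw [h1]; exact e2)
      apply (serKind_r2 r b r' b' hq).1
      rw [hz]; exact serKind_r1 r b r' b' hq'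
    · -- (2,2)
      rw [fibAssign_r2 r b r' b' f g σ τ A B hA1 hB1 hq, fibAssign_r2 r b r' b' f g σ τ A B hA1 hB1 hq'] at he
      obtain ⟨e1, e2⟩ := Prod.mk.inj he
      have hx : q.1.1.1.1 = q'.1.1.1.1 := (mkSlot_inj r b hf e1).1
      have hz : q.1.1.1.2 = q'.1.1.1.2 := hτ _ _ blue.2 blue'.2 e2
      exact ser_slot_ext q q' (Prod.ext hx hz)
        (by rw [ser_idx_zero_of_unit r b r' b' (Or.inl (serKind_r2 r b r' b' hq).2.2),
                ser_idx_zero_of_unit r b r' b' (Or.inl (serKind_r2 r b r' b' hq').2.2)])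
    · -- (2,3)
      exfalso
      rw [fibAssign_r2 r b r' b' f g σ τ A B hA1 hB1 hq, fibAssign_r3 r b r' b' f g σ τ A B hA1 hB1 hq'] at he
      obtain ⟨e1, -⟩ := Prod.mk.inj he
      have hx := (mkSlot_inj r b hf e1).1
      have h1 := (serKind_r2 r b r' b' hq).2.2
      have h2 := (r3_facts r b r' b' hq').2.1
      rw [hx] at h1; omega
    · -- (2,4)
      exfalso
      rw [fibAssign_r2 r b r' b' f g σ τ A B hA1 hB1 hq, fibAssign_r4 r b r' b' f g σ τ A B hA1 hB1 hq'] at he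
      obtain ⟨e1, -⟩ := Prod.mk.inj he
      exact hB5 _ _ _ (r4_dom r b r' b' hq') _ (by simp only [mkSlot_idx]; exact Nat.zero_le _) e1
    · -- (3,1)
      exfalso
      rw [fibAssign_r3 r b r' b' f g σ τ A B hA1 hB1 hq, fibAssign_r1 r b r' b' f g σ τ A B hA1 hB1 hq'] at he
      obtain ⟨-, e2⟩ := Prod.mk.inj he
      exact hA5 _ _ _ (r3_dom r b r' b' hq) _ (Or.inl (serKind_r1 r b r' b' hq').2) e2.symm
    · -- (3,2)
      exfalso
      rw [fibAssign_r3 r b r' b' f g σ τ A B hA1 hB1 hq, fibAssign_r2 r b r' b' f g σ τ A B hA1 hB1 hq'] at he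
      obtain ⟨e1, -⟩ := Prod.mk.inj he
      have hx := (mkSlot_inj r b hf e1).1
      have h1 := (serKind_r2 r b r' b' hq').2.2
      have h2 := (r3_facts r b r' b' hq).2.1
      rw [← hx] at h1; omega
    · -- (3,3)
      rw [fibAssign_r3 r b r' b' f g σ τ A B hA1 hB1 hq, fibAssign_r3 r b r' b' f g σ τ A B hA1 hB1 hq'] at he
      obtain ⟨e1, e2⟩ := Prod.mk.inj he
      obtain ⟨hx, hi⟩ := mkSlot_inj r b hf e1
      have hpair : A q.1.1.1.1 q.1.1.1.2 q.1.2.val = A q.1.1.1.1 q'.1.1.1.2 q'.1.2.val := by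
        have : A q'.1.1.1.1 q'.1.1.1.2 q'.1.2.val = A q.1.1.1.1 q'.1.1.1.2 q'.1.2.val := by rw [hx]
        rw [← this]; exact Prod.ext hi e2
      have hd' : DomA r b r' b' q.1.1.1.1 q'.1.1.1.2 q'.1.2.val := by
        have := r3_dom r b r' b' hq'; rw [← hx] at this; exact this
      obtain ⟨hz, hk⟩ := hA6 _ _ _ _ _ (r3_dom r b r' b' hq) hd' hpair
      exact ser_slot_ext q q' (Prod.ext hx hz) hk
    · -- (3,4)
      exfalso
      rw [fibAssign_r3 r b r' b' f g σ τ A B hA1 hB1 hq, fibAssign_r4 r b r' b' f g σ τ A B hA1 hB1 hq'] at he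
      obtain ⟨e1, e2⟩ := Prod.mk.inj he
      by_cases hle : (A q.1.1.1.1 q.1.1.1.2 q.1.2.val).1 ≤ (B q'.1.1.1.2 q'.1.1.1.1 q'.1.2.val).1
      · exact hB5 _ _ _ (r4_dom r b r' b' hq') _ (by simp only [mkSlot_idx]; exact hle) e1
      · exact hA5 _ _ _ (r3_dom r b r' b' hq) _ (Or.inr (by simp only [mkSlot_idx]; omega)) e2.symm
    · -- (4,1)
      exfalso
      rw [fibAssign_r4 r b r' b' f g σ τ A B hA1 hB1 hq, fibAssign_r1 r b r' b' f g σ τ A B hA1 hB1 hq'] at he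
      obtain ⟨-, e2⟩ := Prod.mk.inj he
      have hz := (mkSlot_inj r' b' hg e2).1
      have h1 := (serKind_r1 r b r' b' hq').2
      have h2 := (r4_facts r b r' b' hq).2.1
      rw [← hz] at h1; omega
    · -- (4,2)
      exfalso
      rw [fibAssign_r4 r b r' b' f g σ τ A B hA1 hB1 hq, fibAssign_r2 r b r' b' f g σ τ A B hA1 hB1 hq'] at he
      obtain ⟨e1, -⟩ := Prod.mk.inj he
      exact hB5 _ _ _ (r4_dom r b r' b' hq) _ (by simp only [mkSlot_idx]; exact Nat.zero_le _) e1.symm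
    · -- (4,3)
      exfalso
      rw [fibAssign_r4 r b r' b' f g σ τ A B hA1 hB1 hq, fibAssign_r3 r b r' b' f g σ τ A B hA1 hB1 hq'] at he
      obtain ⟨e1, e2⟩ := Prod.mk.inj he
      by_cases hle : (A q'.1.1.1.1 q'.1.1.1.2 q'.1.2.val).1 ≤ (B q.1.1.1.2 q.1.1.1.1 q.1.2.val).1
      · exact hB5 _ _ _ (r4_dom r b r' b' hq) _ (by simp only [mkSlot_idx]; exact hle) e1.symm
      · exact hA5 _ _ _ (r3_dom r b r' b' hq') _ (Or.inr (by simp only [mkSlot_idx]; omega)) e2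
    · -- (4,4)
      rw [fibAssign_r4 r b r' b' f g σ τ A B hA1 hB1 hq, fibAssign_r4 r b r' b' f g σ τ A B hA1 hB1 hq'] at he
      obtain ⟨e1, e2⟩ := Prod.mk.inj he
      obtain ⟨hz, hj⟩ := mkSlot_inj r' b' hg e2
      have hpair : B q.1.1.1.2 q.1.1.1.1 q.1.2.val = B q.1.1.1.2 q'.1.1.1.1 q'.1.2.val := by
        have : B q'.1.1.1.2 q'.1.1.1.1 q'.1.2.val = B q.1.1.1.2 q'.1.1.1.1 q'.1.2.val := by rw [hz]
        rw [← this]; exact Prod.ext hj e1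
      have hd' : DomB r b r' b' q.1.1.1.2 q'.1.1.1.1 q'.1.2.val := by
        have := r4_dom r b r' b' hq'; rw [← hz] at this; exact this
      obtain ⟨hx, hk⟩ := hB6 _ _ _ _ _ (r4_dom r b r' b' hq) hd' hpair
      exact ser_slot_ext q q' (Prod.ext hx hz) hk
  · -- the assignment properties
    intro q
    have blue := ser_src_blue r b r' b' q.1.1.2.1
    rcases hq : serKind r b r' b' q with _ | _ | _ | _
    · rw [fibAssign_r1 r b r' b' f g σ τ A B hA1 hB1 hq]
      obtain ⟨l1, r1⟩ := hσs _ blue.1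
      obtain ⟨l2, r2, -⟩ := hgs (mkSlot r' b' q.1.1.1.2 (r1_src r b r' b' hq) 0 (r1_pos r b r' b' hq))
      simp only [mkSlot_src] at l2
      refine ⟨Prod.mk_le_mk.2 ⟨l1, l2⟩, ?_, ?_⟩
      · simp only [serR]; omega
      · have := (serKind_r1 r b r' b' hq).2; simp only [serB]; omega
    · rw [fibAssign_r2 r b r' b' f g σ τ A B hA1 hB1 hq]
      obtain ⟨l1, r1, -⟩ := hfs (mkSlot r b q.1.1.1.1 (r2_src r b r' b' hq) 0 (r2_pos r b r' b' hq))
      simp only [mkSlot_src] at l1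
      obtain ⟨l2, r2⟩ := hτs _ blue.2
      refine ⟨Prod.mk_le_mk.2 ⟨l1, l2⟩, ?_, ?_⟩
      · simp only [serR]; omega
      · have := (serKind_r2 r b r' b' hq).2.2; simp only [serB]; omega
    · rw [fibAssign_r3 r b r' b' f g σ τ A B hA1 hB1 hq]
      have hd := r3_dom r b r' b' hq
      obtain ⟨l1, r1, d1⟩ := hfs (mkSlot r b q.1.1.1.1 (r3_src r b r' b' hq) (A q.1.1.1.1 q.1.1.1.2 q.1.2.val).1
          (hA1 _ _ _ (r3_src r b r' b' hq) (r3_facts r b r' b' hq).2.1 (r3_facts r b r' b' hq).2.2.1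
            (r3_facts r b r' b' hq).2.2.2 (r3_idx r b r' b' hq)))
      simp only [mkSlot_src] at l1 d1
      have l2 := hA2 _ _ _ hd
      have r2 := hA3 _ _ _ hd
      have d2 := hA4 _ _ _ hd
      refine ⟨Prod.mk_le_mk.2 ⟨l1, l2⟩, ?_, ?_⟩
      · simp only [serR]; omega
      · simp only [serB]; omega
    · rw [fibAssign_r4 r b r' b' f g σ τ A B hA1 hB1 hq]
      have hd := r4_dom r b r' b' hq
      obtain ⟨l2, r2, d2⟩ := hgs (mkSlot r' b' q.1.1.1.2 (r4_src r b r' b' hq) (B q.1.1.1.2 q.1.1.1.1 q.1.2.val).1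
          (hB1 _ _ _ (r4_src r b r' b' hq) (r4_facts r b r' b' hq).2.1 (r4_facts r b r' b' hq).2.2.1
            (r4_facts r b r' b' hq).2.2.2 (r4_idx r b r' b' hq)))
      simp only [mkSlot_src] at l2 d2
      have l1 := hB2 _ _ _ hd
      have r1 := hB3 _ _ _ hd
      have d1 := hB4 _ _ _ hd
      refine ⟨Prod.mk_le_mk.2 ⟨l1, l2⟩, ?_, ?_⟩
      · simp only [serR]; omega
      · simp only [serB]; omega

end main

end Summit.Ventures.PercRepro2.UHClosure
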